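import Mathlib
import Literature.AlgebraicGeometry.Resolution.CobordantBlowupGlobal
import Literature.AlgebraicGeometry.Resolution.BlowupPrincipalCharts
import Summits.ResolutionOfSingularities.ResolutionOfSingularities.Theorems.WeightedInvariantDefs
import Summits.ResolutionOfSingularities.ResolutionOfSingularities.Theorems.WeightedInvariantDatumToEmbeddedAtlasDefs
import HarnessLib

/-!
# The graded atlas on the cobordant blow-up: pull-back identities (crux `DatumToEmbedded`, line `Sketch`)

Support file for the lead's stub `stub_qs_atlas` of the line `Sketch` of the crux
`Theses.WeightedInvariant.DatumToEmbedded` (stmt-ResolutionOfSingularities-0572): the assembly of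
the graded atlas of rank `j + 1` (`GradedAtlas`, `Theorems/WeightedInvariantDefs.lean`) on the
strict transform `X' ⊆ B₊ = R'.plus` over the blow-up `V' = Bl_K V` of the quotient, from the
ambient charts (`AmbientChart`, `Theorems/WeightedInvariantDatumToEmbeddedAtlasDefs.lean`) and the
principal charts downstairs (Włodarczyk, arXiv:2203.03090, §2.3.3).

This file: the bookkeeping of the commutative squares

  `X' --i'--> B₊ --π₊--> Y`,  `X' --σX--> X --i--> Y`  (`σX ≫ i = i' ≫ π₊`),
  `X' --q'--> V' --ρ--> V`,   `X' --σX--> X --q--> V`  (`q' ≫ ρ = σX ≫ q`),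

on sections over charts `W' ⊆ π₊⁻¹(W a)`, `U' ⊆ ρ⁻¹(U a)` with `i'⁻¹ W' ≤ q'⁻¹ U'`:

* `app_appLE_eq` — `i'♯(π₊♯ z) = σX♯(i♯ z)`; `appLE_appLE_eq` — `q'♯(ρ♯ y) = σX♯(q♯ y)`; hence
  the KEY IDENTITY `app_appLE_eq_appLE_appLE`: if `i♯ z = q♯ y` then `i'♯(π₊♯ z) = q'♯(ρ♯ y)`;
* `isUnit_app_appLE` — a section of `W a` that is a unit on `X ∩ W a` pulls back to a unit on
  `X' ∩ W'`; `appLE_injective_of_eq` — `q'♯ : Γ(V', U') → Γ(X', i'⁻¹ W')` is injective as soon as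
  `q'♯ : Γ(V', U') → Γ(X', q'⁻¹ U')` is and `i'⁻¹ W' = q'⁻¹ U'`;
* `app_tInvOn_mem_nonZeroDivisors` — on an INTEGRAL `X'` on which `t⁻¹` is not identically zero,
  `i'♯(t⁻¹|_{W'})` is a non-zero-divisor of `Γ(X', i'⁻¹ W')` (its non-vanishing locus is
  `i'⁻¹ W' ∩ {t⁻¹ ≠ 0}`, and two non-empty opens of an irreducible space meet; the empty case is
  the zero ring); `app_eta_mul_mem_nonZeroDivisors` — so is `E = i'♯(η (t⁻¹)^{Dg})` for an
  ambient chart;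
* `appLE_eq_app_of_mul_pow_eq` — THE CANCELLATION: if `c' ρ♯b^l = ρ♯c`, `i♯ x = q♯ c` and
  `s η^l (t⁻¹)^{Dg l} = π₊♯ x` then `q'♯ c' = i'♯ s` (both sides times `E^l` agree).

All proofs are glue on Mathlib and the tree; no definitions, no named facts.
-/

noncomputable section

open CategoryTheory AlgebraicGeometry TopologicalSpace
open Literature.AlgebraicGeometry.Resolution
open scoped nonZeroDivisors

set_option linter.dupNamespace false -- mandated namespace `…Theorems.DatumToEmbedded.<Topic>`
-- `Γ(B₊, W')` versus `presheaf.obj` inside `rw` motives and instance problems on the glued scheme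
-- `R'.cobordantBlowup` / `R'.plus` (as in `…DatumToEmbedded.AtlasAmbientChart`):
set_option backward.isDefEq.respectTransparency false

namespace Summit.ResolutionOfSingularities.ResolutionOfSingularities.Theorems.DatumToEmbedded.Atlas

/-! ## Sections along the two commutative squares -/

section Square

variable {X' B X Y V V' : Scheme.{0}} {i' : X' ⟶ B} {π : B ⟶ Y} {σ : X' ⟶ X} {i : X ⟶ Y}
  {q : X ⟶ V} {q' : X' ⟶ V'} {ρ : V' ⟶ V}

/-- For `W' ⊆ π⁻¹(W a)` and `σ ≫ i = i' ≫ π`: `i'⁻¹ W' ⊆ σ⁻¹(i⁻¹ W a)`. [folklore] -/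
theorem preimage_le_of_sq (H : σ ≫ i = i' ≫ π) {Wa : Y.Opens} {W' : B.Opens}
    (hW : W' ≤ π ⁻¹ᵁ Wa) : i' ⁻¹ᵁ W' ≤ σ ⁻¹ᵁ (i ⁻¹ᵁ Wa) := by
  rw [← Scheme.Hom.comp_preimage, H, Scheme.Hom.comp_preimage]
  exact i'.preimage_mono hW

/-- **`i'♯ ∘ π♯ = σ♯ ∘ i♯` on sections**: for `σ ≫ i = i' ≫ π`, `W' ⊆ π⁻¹(W a)` and a section
`z` of `Y` over `W a`, `i'♯(π♯ z) = σ♯(i♯ z)` in `Γ(X', i'⁻¹ W')`. [folklore] -/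
theorem app_appLE_eq (H : σ ≫ i = i' ≫ π) {Wa : Y.Opens} {W' : B.Opens} (hW : W' ≤ π ⁻¹ᵁ Wa)
    (h₁ : i' ⁻¹ᵁ W' ≤ σ ⁻¹ᵁ (i ⁻¹ᵁ Wa)) (z : Γ(Y, Wa)) :
    i'.app W' (π.appLE Wa W' hW z) = σ.appLE (i ⁻¹ᵁ Wa) (i' ⁻¹ᵁ W') h₁ (i.app Wa z) := by
  have e1 : i'.app W' (π.appLE Wa W' hW z) =
      (π.appLE Wa W' hW ≫ i'.appLE W' (i' ⁻¹ᵁ W') le_rfl) z := by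
    rw [← Scheme.Hom.app_eq_appLE]; rfl
  rw [e1, Scheme.Hom.appLE_comp_appLE, appLE_congr_hom H.symm Wa (i' ⁻¹ᵁ W'),
    Scheme.Hom.comp_appLE]
  rfl

/-- **`q'♯ ∘ ρ♯ = σ♯ ∘ q♯` on sections**: for `q' ≫ ρ = σ ≫ q`, `U' ⊆ ρ⁻¹(U a)`,
`i⁻¹ W a ⊆ q⁻¹ U a`, `i'⁻¹ W' ⊆ q'⁻¹ U'`, `i'⁻¹ W' ⊆ σ⁻¹(i⁻¹ W a)` and a section `y` of `V`
over `U a`, `q'♯(ρ♯ y) = σ♯(q♯ y)` in `Γ(X', i'⁻¹ W')`. [folklore] -/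
theorem appLE_appLE_eq (hq' : q' ≫ ρ = σ ≫ q) {Wa : Y.Opens} {W' : B.Opens} {Ua : V.Opens}
    {U' : V'.Opens} (hU : U' ≤ ρ ⁻¹ᵁ Ua) (hpre : i ⁻¹ᵁ Wa ≤ q ⁻¹ᵁ Ua)
    (h' : i' ⁻¹ᵁ W' ≤ q' ⁻¹ᵁ U') (h₁ : i' ⁻¹ᵁ W' ≤ σ ⁻¹ᵁ (i ⁻¹ᵁ Wa)) (y : Γ(V, Ua)) :
    q'.appLE U' (i' ⁻¹ᵁ W') h' (ρ.appLE Ua U' hU y) =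
      σ.appLE (i ⁻¹ᵁ Wa) (i' ⁻¹ᵁ W') h₁ (q.appLE Ua (i ⁻¹ᵁ Wa) hpre y) := by
  have e1 : q'.appLE U' (i' ⁻¹ᵁ W') h' (ρ.appLE Ua U' hU y) =
      (ρ.appLE Ua U' hU ≫ q'.appLE U' (i' ⁻¹ᵁ W') h') y := rfl
  have e2 : σ.appLE (i ⁻¹ᵁ Wa) (i' ⁻¹ᵁ W') h₁ (q.appLE Ua (i ⁻¹ᵁ Wa) hpre y) =
      (q.appLE Ua (i ⁻¹ᵁ Wa) hpre ≫ σ.appLE (i ⁻¹ᵁ Wa) (i' ⁻¹ᵁ W') h₁) y := rfl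
  rw [e1, e2, Scheme.Hom.appLE_comp_appLE, Scheme.Hom.appLE_comp_appLE,
    appLE_congr_hom hq' Ua (i' ⁻¹ᵁ W')]

/-- **KEY IDENTITY.** In the situation of `app_appLE_eq`/`appLE_appLE_eq`: if `i♯ z = q♯ y`
then `i'♯(π♯ z) = q'♯(ρ♯ y)`. [folklore] -/
theorem app_appLE_eq_appLE_appLE (H : σ ≫ i = i' ≫ π) (hq' : q' ≫ ρ = σ ≫ q) {Wa : Y.Opens}
    {W' : B.Opens} {Ua : V.Opens} {U' : V'.Opens} (hW : W' ≤ π ⁻¹ᵁ Wa) (hU : U' ≤ ρ ⁻¹ᵁ Ua)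
    (hpre : i ⁻¹ᵁ Wa ≤ q ⁻¹ᵁ Ua) (h' : i' ⁻¹ᵁ W' ≤ q' ⁻¹ᵁ U') {y : Γ(V, Ua)} {z : Γ(Y, Wa)}
    (hz : i.app Wa z = q.appLE Ua (i ⁻¹ᵁ Wa) hpre y) :
    i'.app W' (π.appLE Wa W' hW z) = q'.appLE U' (i' ⁻¹ᵁ W') h' (ρ.appLE Ua U' hU y) := by
  rw [app_appLE_eq H hW (preimage_le_of_sq H hW), hz,
    ← appLE_appLE_eq hq' hU hpre h' (preimage_le_of_sq H hW)]

/-- **Units on `X ∩ W a` pull back to units on `X' ∩ W'`.** [folklore] -/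
theorem isUnit_app_appLE (H : σ ≫ i = i' ≫ π) {Wa : Y.Opens} {W' : B.Opens} (hW : W' ≤ π ⁻¹ᵁ Wa)
    {z : Γ(Y, Wa)} (hz : IsUnit (i.app Wa z)) : IsUnit (i'.app W' (π.appLE Wa W' hW z)) := by
  rw [app_appLE_eq H hW (preimage_le_of_sq H hW)]
  exact hz.map _

/-- `q'♯ : Γ(V', U') → Γ(X', O)` is injective for `O = q'⁻¹ U'` as soon as `q'.app U'` is.
[folklore] -/
theorem appLE_injective_of_eq (U' : V'.Opens) {O : X'.Opens} (e : O = q' ⁻¹ᵁ U')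
    (hinj : Function.Injective (q'.app U')) : Function.Injective (q'.appLE U' O e.le) := by
  subst e
  rw [Scheme.Hom.appLE_eq_app]
  exact hinj

end Square

/-! ## The non-zero-divisor `t⁻¹` on the integral strict transform -/

section NonZeroDivisor

variable {Y : Scheme.{0}} (R' : ReesFiltration Y) {X' : Scheme.{0}} [IsIntegral X']
  (i' : X' ⟶ R'.plus)
  (hτ : (((i' ≫ R'.plus.ι ≫ R'.toA1) ⁻¹ᵁ
    PrimeSpectrum.basicOpen (Polynomial.X : Polynomial ReesFiltration.ZZ.{0}) : X'.Opens) :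
      Set X').Nonempty)

omit [IsIntegral X'] in
/-- The non-vanishing locus of `i'♯(t⁻¹|_{W'})` is `i'⁻¹ W' ∩ {t⁻¹ ≠ 0}`. [folklore] -/
theorem basicOpen_app_tInvOn (W' : (R'.plus : Scheme.{0}).Opens) :
    X'.basicOpen (i'.app W' (tInvOn R' W')) = i' ⁻¹ᵁ W' ⊓ (i' ≫ R'.plus.ι ≫ R'.toA1) ⁻¹ᵁ
      PrimeSpectrum.basicOpen (Polynomial.X : Polynomial ReesFiltration.ZZ.{0}) := by
  have e1 : i'.app W' (tInvOn R' W') = ((R'.plus.ι ≫ R'.toA1).appLE ⊤ W' le_top ≫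
      i'.appLE W' (i' ⁻¹ᵁ W') le_rfl)
        ((Scheme.ΓSpecIso (CommRingCat.of (Polynomial ReesFiltration.ZZ.{0}))).inv
          Polynomial.X) := by
    rw [← Scheme.Hom.app_eq_appLE]; rfl
  rw [e1, Scheme.Hom.appLE_comp_appLE, Scheme.basicOpen_appLE, basicOpen_eq_of_affine]

include hτ in
/-- **`i'♯(t⁻¹|_{W'})` is a non-zero-divisor of `Γ(X', i'⁻¹ W')`** when `X'` is integral and
`t⁻¹` is not identically zero on `X'`: if `y · i'♯(t⁻¹) = 0` with `y ≠ 0`, the non-empty opens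
`D(y)` and `{t⁻¹ ≠ 0}` of the irreducible `X'` meet inside `D(y · i'♯ t⁻¹) = ∅`. [folklore] -/
theorem app_tInvOn_mem_nonZeroDivisors (W' : (R'.plus : Scheme.{0}).Opens) :
    i'.app W' (tInvOn R' W') ∈ Γ(X', i' ⁻¹ᵁ W')⁰ := by
  rw [mem_nonZeroDivisors_iff_right]
  intro y hy
  by_contra hy0
  have hne : ((X'.basicOpen y : X'.Opens) : Set X').Nonempty := by
    rw [Set.nonempty_iff_ne_empty, Ne, Opens.coe_eq_empty, basicOpen_eq_bot_iff]
    exact hy0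
  obtain ⟨z, hz1, hz2⟩ := nonempty_preirreducible_inter (X'.basicOpen y).isOpen
    ((i' ≫ R'.plus.ι ≫ R'.toA1) ⁻¹ᵁ
      PrimeSpectrum.basicOpen (Polynomial.X : Polynomial ReesFiltration.ZZ.{0})).isOpen hne hτ
  have hz : z ∈ X'.basicOpen (y * i'.app W' (tInvOn R' W')) := by
    rw [Scheme.basicOpen_mul, basicOpen_app_tInvOn]
    exact ⟨hz1, X'.basicOpen_le y hz1, hz2⟩
  rw [hy, Scheme.basicOpen_zero] at hz
  exact hz

include hτ in
/-- **The non-zero-divisor `E = i'♯(η (t⁻¹)^{Dg})` of an ambient chart**: `η` is a unit and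
`i'♯ t⁻¹` is a non-zero-divisor. [folklore] -/
theorem app_eta_mul_mem_nonZeroDivisors {k : Type} [Field k] {X V : Scheme.{0}}
    {f : Y ⟶ Spec (.of k)} {i : X ⟶ Y} [IsClosedImmersion i] {q : X ⟶ V} {j : ℕ}
    {𝒜 : GradedAtlas j f i q} {J : ℕ → Y.IdealSheafData} {Dg : ℕ} {a : 𝒜.ι} {β : Γ(Y, 𝒜.W a)}
    (𝒞 : AmbientChart j f i q 𝒜 J R' Dg a β) :
    i'.app 𝒞.W' (𝒞.η * tInvOn R' 𝒞.W' ^ Dg) ∈ Γ(X', i' ⁻¹ᵁ 𝒞.W')⁰ := by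
  rw [map_mul, map_pow]
  exact Submonoid.mul_mem _ (𝒞.isUnit_η.map _).mem_nonZeroDivisors
    (Submonoid.pow_mem _ (app_tInvOn_mem_nonZeroDivisors R' i' hτ 𝒞.W') Dg)

end NonZeroDivisor

/-! ## The cancellation on one chart -/

section Cancel

variable {k : Type} [Field k] {Y X V X' V' : Scheme.{0}} {f : Y ⟶ Spec (.of k)} {i : X ⟶ Y}
  [IsClosedImmersion i] {q : X ⟶ V} {j : ℕ} {𝒜 : GradedAtlas j f i q}
  {J : ℕ → Y.IdealSheafData} {R' : ReesFiltration Y} {Dg : ℕ} [IsIntegral X']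
  {i' : X' ⟶ R'.plus} {σX : X' ⟶ X} (hσX : σX ≫ i = i' ≫ R'.πPlus)
  (hτ : (((i' ≫ R'.plus.ι ≫ R'.toA1) ⁻¹ᵁ
    PrimeSpectrum.basicOpen (Polynomial.X : Polynomial ReesFiltration.ZZ.{0}) : X'.Opens) :
      Set X').Nonempty)
  {ρ : V' ⟶ V} {q' : X' ⟶ V'} (hq' : q' ≫ ρ = σX ≫ q)
  {a : 𝒜.ι} {b : Γ(V, 𝒜.U a)} {β : Γ(Y, 𝒜.W a)}
  (hβ : i.app (𝒜.W a) β = q.appLE (𝒜.U a) (i ⁻¹ᵁ (𝒜.W a)) (𝒜.preimage_eq a).le b)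
  (𝒞 : AmbientChart j f i q 𝒜 J R' Dg a β)
  {U' : V'.Opens} (hU' : U' ≤ ρ ⁻¹ᵁ (𝒜.U a : V.Opens))
  (hQ1 : i' ⁻¹ᵁ (𝒞.W' : (R'.plus : Scheme.{0}).Opens) = q' ⁻¹ᵁ U')

omit [IsIntegral X'] in
include hσX hq' hβ in
/-- **`E = i'♯(η (t⁻¹)^{Dg}) = q'♯(ρ♯ b)`** on the chart (from `η (t⁻¹)^{Dg} = π₊♯ β`,
`i♯ β = q♯ b` and the key identity). [folklore] -/
theorem app_eta_mul_eq :
    i'.app 𝒞.W' (𝒞.η * tInvOn R' 𝒞.W' ^ Dg) =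
      q'.appLE U' (i' ⁻¹ᵁ (𝒞.W' : (R'.plus : Scheme.{0}).Opens)) hQ1.le
        (ρ.appLE (𝒜.U a) U' hU' b) := by
  rw [𝒞.η_mul]
  exact app_appLE_eq_appLE_appLE hσX hq' 𝒞.le_preimage hU' (𝒜.preimage_eq a).le hQ1.le hβ

include hσX hτ hq' hβ in
/-- **THE CANCELLATION.** On the chart: if `c' · ρ♯b^l = ρ♯c` in `Γ(V', U')`, `i♯ x = q♯ c` and
`s · η^l · (t⁻¹)^{Dg l} = π₊♯ x` in `Γ(B₊, W')`, then `q'♯ c' = i'♯ s` in `Γ(X', i'⁻¹ W')`: both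
sides multiplied by `E^l`, `E = i'♯(η (t⁻¹)^{Dg}) = q'♯ ρ♯ b` a non-zero-divisor, give
`q'♯ ρ♯ c = i'♯ π₊♯ x`. [cite: Wlodarczyk2022, §2.3.3] -/
theorem appLE_eq_app_of_mul_pow_eq {l : ℕ} {c' : Γ(V', U')} {c : Γ(V, 𝒜.U a)}
    {x : Γ(Y, 𝒜.W a)} {s : Γ((R'.plus : Scheme.{0}), 𝒞.W')}
    (hc' : c' * ρ.appLE (𝒜.U a) U' hU' b ^ l = ρ.appLE (𝒜.U a) U' hU' c)
    (hx : i.app (𝒜.W a) x = q.appLE (𝒜.U a) (i ⁻¹ᵁ (𝒜.W a)) (𝒜.preimage_eq a).le c)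
    (hs : s * 𝒞.η ^ l * tInvOn R' 𝒞.W' ^ (Dg * l) =
      R'.πPlus.appLE (𝒜.W a) 𝒞.W' 𝒞.le_preimage x) :
    q'.appLE U' (i' ⁻¹ᵁ (𝒞.W' : (R'.plus : Scheme.{0}).Opens)) hQ1.le c' = i'.app 𝒞.W' s := by
  have hE := app_eta_mul_eq hσX hq' hβ 𝒞 hU' hQ1
  have hnzd := Submonoid.pow_mem _ (app_eta_mul_mem_nonZeroDivisors R' i' hτ 𝒞) l
  rw [← mul_cancel_right_mem_nonZeroDivisors hnzd]
  calc q'.appLE U' _ hQ1.le c' * i'.app 𝒞.W' (𝒞.η * tInvOn R' 𝒞.W' ^ Dg) ^ l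
      = q'.appLE U' _ hQ1.le (c' * ρ.appLE (𝒜.U a) U' hU' b ^ l) := by
        rw [hE, map_mul, map_pow]
    _ = i'.app 𝒞.W' (R'.πPlus.appLE (𝒜.W a) 𝒞.W' 𝒞.le_preimage x) := by
        rw [hc']
        exact (app_appLE_eq_appLE_appLE hσX hq' 𝒞.le_preimage hU' (𝒜.preimage_eq a).le
          hQ1.le hx).symm
    _ = i'.app 𝒞.W' s * i'.app 𝒞.W' (𝒞.η * tInvOn R' 𝒞.W' ^ Dg) ^ l := by
        rw [← hs, ← map_pow, ← map_mul]
        congr 1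
        ring

end Cancel

/-! ## Registered form -/

/-- **Registered sub-goal `stub_qs_atlasBridge`** of the lead's `stub_qs_atlas` (this helper file):
the cancellation `q'♯ c' = i'♯ s` on one chart of the new atlas (`appLE_eq_app_of_mul_pow_eq`).
[cite: Wlodarczyk2022, §2.3.3] -/
theorem stub_qs_atlasBridge :
    ∀ {k : Type} [Field k] {Y X V X' V' : Scheme.{0}} {f : Y ⟶ Spec (.of k)} {i : X ⟶ Y}
      [IsClosedImmersion i] {q : X ⟶ V} {j : ℕ} {𝒜 : GradedAtlas j f i q}
      {J : ℕ → Y.IdealSheafData} {R' : ReesFiltration Y} {Dg : ℕ} [IsIntegral X']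
      {i' : X' ⟶ R'.plus} {σX : X' ⟶ X}, σX ≫ i = i' ≫ R'.πPlus →
      (((i' ≫ R'.plus.ι ≫ R'.toA1) ⁻¹ᵁ
        PrimeSpectrum.basicOpen (Polynomial.X : Polynomial ReesFiltration.ZZ.{0}) : X'.Opens) :
          Set X').Nonempty →
      ∀ {ρ : V' ⟶ V} {q' : X' ⟶ V'}, q' ≫ ρ = σX ≫ q →
      ∀ {a : 𝒜.ι} {b : Γ(V, 𝒜.U a)} {β : Γ(Y, 𝒜.W a)},
        i.app (𝒜.W a) β = q.appLE (𝒜.U a) (i ⁻¹ᵁ (𝒜.W a)) (𝒜.preimage_eq a).le b →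
      ∀ (𝒞 : AmbientChart j f i q 𝒜 J R' Dg a β) {U' : V'.Opens}
        (hU' : U' ≤ ρ ⁻¹ᵁ (𝒜.U a : V.Opens))
        (hQ1 : i' ⁻¹ᵁ (𝒞.W' : (R'.plus : Scheme.{0}).Opens) = q' ⁻¹ᵁ U')
        {l : ℕ} {c' : Γ(V', U')} {c : Γ(V, 𝒜.U a)} {x : Γ(Y, 𝒜.W a)}
        {s : Γ((R'.plus : Scheme.{0}), 𝒞.W')},
        c' * ρ.appLE (𝒜.U a) U' hU' b ^ l = ρ.appLE (𝒜.U a) U' hU' c →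
        i.app (𝒜.W a) x = q.appLE (𝒜.U a) (i ⁻¹ᵁ (𝒜.W a)) (𝒜.preimage_eq a).le c →
        s * 𝒞.η ^ l * tInvOn R' 𝒞.W' ^ (Dg * l) = R'.πPlus.appLE (𝒜.W a) 𝒞.W' 𝒞.le_preimage x →
        q'.appLE U' (i' ⁻¹ᵁ (𝒞.W' : (R'.plus : Scheme.{0}).Opens)) hQ1.le c' = i'.app 𝒞.W' s :=
  fun hσX hτ _ _ hq' _ _ _ hβ 𝒞 _ hU' hQ1 _ _ _ _ _ hc' hx hs =>
    appLE_eq_app_of_mul_pow_eq hσX hτ hq' hβ 𝒞 hU' hQ1 hc' hx hs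

end Summit.ResolutionOfSingularities.ResolutionOfSingularities.Theorems.DatumToEmbedded.Atlas

end
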